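import Mathlib.Algebra.CharP.Invertible
import Mathlib.LinearAlgebra.ExteriorPower.Basic
import Mathlib.LinearAlgebra.ExteriorPower.Basis
import Literature.AlgebraicTopology.SingularHomology.CupProductProofs
import HarnessLib

/-!
# Cup powers of degree-one classes and the comparison map `⋀ᵈ H¹(X; R) → Hᵈ(X; R)`

For a topological space `X` and a commutative ring `R`, the cup product makes `H•(X; R)` a
graded-commutative ring (Hatcher, *Algebraic Topology*, §3.2, Thm. 3.11; the tree's `cupProduct`,
`cupProduct_assoc`, `one_cupProduct`, `cupProduct_gradedComm_holds`).  Hence the iterated product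
`m_d(v₀, …, v_{d-1}) = v₀ ⌣ v₁ ⌣ ⋯ ⌣ v_{d-1}` of degree-one classes is multilinear and — as soon as `2`
is invertible in `R`, so that `v ⌣ v = -v ⌣ v` forces `v ⌣ v = 0` — alternating, and so factors through
the exterior power: the **comparison map** `⋀ᵈ H¹(X; R) → Hᵈ(X; R)`, `v₀ ∧ ⋯ ∧ v_{d-1} ↦ v₀ ⌣ ⋯ ⌣ v_{d-1}`.
It is natural in `X`.  For an `n`-torus (and a complex torus / complex abelian variety) it is an
isomorphism in every degree: `H•(Tⁿ; R) = Λ_R[α₁, …, αₙ]` (Hatcher, Example 3.13 / 3.16, by the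
Künneth formula); this file only DEFINES the predicate `HasExteriorCohomologyH1 R X` ("`H•(X; R)` is
the exterior algebra on `H¹`") and derives its formal consequences; the theorem for abelian varieties
is the named fact of `Literature/AlgebraicGeometry/Motives/AbelianVarietyCohomologyExteriorH1`.

The constructions mirror, on the REAL carriers `singularCohomology R R X`, the abstract
Weil-cohomology version `Motives.WeilCohomology.prodMap` / `prodAlt` of
`Literature/AlgebraicGeometry/Motives/AbelianVarietyExterior` (there for an abstract `W`).

## Main definitions

* `cupPowOne R X d : MultilinearMap R (fun _ : Fin d ↦ H¹(X; R)) (Hᵈ(X; R))` — the iterated cup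
  product `m_d(v) = v₀ ⌣ (v₁ ⌣ (⋯ ⌣ (v_{d-1} ⌣ 1)))`.
* `cupPowOneAlt R X d : H¹(X; R) [⋀^Fin d]→ₗ[R] Hᵈ(X; R)` — the same, as an alternating map
  (`[Invertible (2 : R)]`).
* `wedgeToCup R X d : ⋀[R]^d H¹(X; R) →ₗ[R] Hᵈ(X; R)` — the comparison map (Mathlib
  `exteriorPower.alternatingMapLinearEquiv`).
* `HasExteriorCohomologyH1 R X : Prop` — every `wedgeToCup R X d` is bijective.

## Main results (all proved)

* `cup_self_deg_one`: `v ⌣ v = 0` for `v ∈ H¹` when `⅟2 ∈ R`; `cupPowOne_eq_zero_of_eq` (alternating).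
* `map_cupPowOne`, `map_comp_wedgeToCup`: naturality `f^*(v₀ ⌣ ⋯ ⌣ v_{d-1}) = f^*v₀ ⌣ ⋯ ⌣ f^*v_{d-1}`,
  i.e. `f^* ∘ wedgeToCup = wedgeToCup ∘ ⋀ᵈ(f^*|_{H¹})` (Hatcher, Prop. 3.10).
* `HasExteriorCohomologyH1.equiv`, `.finrank_eq` (`dim Hᵈ = (dim H¹ choose d)`),
  `.subsingleton_of_lt` (`Hᵈ = 0` for `d > dim H¹`), `.span_range_cupPowOne` (`Hᵈ` is spanned by
  products of degree-one classes).

## Design notes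

* `[Invertible (2 : R)]` (Mathlib: automatic for division rings of characteristic zero, e.g. `ℚ`,
  `ℂ`) is exactly what makes "graded-commutative" imply "alternating" in degree one; without it the
  statement is false (`H•(ℝP^∞; 𝔽₂) = 𝔽₂[α]`, `|α| = 1`).
* Universes as in `singularCohomology`: `X : Type u`, `R : Type v`, `Hⁿ(X; R) : ModuleCat.{max u v} R`.
* Not here: the Künneth formula and the torus computation (named fact downstream).

## References

* [Hatcher2002] A. Hatcher, *Algebraic Topology* (2002), §3.2: Prop. 3.10 (naturality), Thm. 3.11
  (graded commutativity), Example 3.13 and Example 3.16 (`H•(Tⁿ; R) = Λ_R[α₁, …, αₙ]`).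
* [LangeBirkenhake1992] H. Lange, Ch. Birkenhake, *Complex Abelian Varieties* (1992), Lemma 1.1.17 (b),
  Exercise 1.1.6 (7) ("the canonical map `∧ⁿ H¹(X, ℤ) → Hⁿ(X, ℤ)` induced by the cup product").
-/

noncomputable section

open CategoryTheory

universe u v

namespace Literature.AlgebraicTopology.SingularHomology

variable (R : Type v) [CommRing R] (X : Type u) [TopologicalSpace X] {Y : Type u} [TopologicalSpace Y]

/-! ### The iterated cup product of degree-one classes -/

/-- Left cup product by a degree-one class composed with a multilinear map `H¹(X)^d → Hᵈ(X)`,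
linearly in the class (auxiliary for `cupPowOne`). [folklore] -/
def cupConsOne (d : ℕ)
    (f : MultilinearMap R (fun _ : Fin d => ↥(singularCohomology R R X 1)) (singularCohomology R R X d)) :
    singularCohomology R R X 1 →ₗ[R]
      MultilinearMap R (fun _ : Fin d => ↥(singularCohomology R R X 1)) (singularCohomology R R X (d + 1)) where
  toFun v := (cupProduct (Nat.add_comm 1 d) v).compMultilinearMap f
  map_add' v w := by ext u; simp
  map_smul' c v := by ext u; simp

/-- The **iterated cup product of degree-one classes**
`m_d(v₀, …, v_{d-1}) = v₀ ⌣ (v₁ ⌣ (⋯ ⌣ (v_{d-1} ⌣ 1)))`, as a multilinear map `H¹(X; R)^d → Hᵈ(X; R)`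
(Hatcher, §3.2: the cup product is bilinear and associative with unit `1 ∈ H⁰`). [cite: Hatcher2002, §3.2] -/
def cupPowOne : (d : ℕ) →
    MultilinearMap R (fun _ : Fin d => ↥(singularCohomology R R X 1)) (singularCohomology R R X d)
  | 0 => MultilinearMap.constOfIsEmpty R _ (singularCohomology.one R X)
  | d + 1 => LinearMap.uncurryLeft (cupConsOne R X d (cupPowOne d))

/-- `m₀ = 1`. [folklore] -/
@[simp]
lemma cupPowOne_zero (v : Fin 0 → singularCohomology R R X 1) :
    cupPowOne R X 0 v = singularCohomology.one R X := rfl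

/-- `m_{d+1}(v) = v₀ ⌣ m_d(tail v)`. [folklore] -/
lemma cupPowOne_succ (d : ℕ) (v : Fin (d + 1) → singularCohomology R R X 1) :
    cupPowOne R X (d + 1) v = cupProduct (Nat.add_comm 1 d) (v 0) (cupPowOne R X d (Fin.tail v)) := rfl

/-- `w ⌣ m_d(u) = m_{d+1}(w, u)`. [folklore] -/
lemma cupProduct_cupPowOne (d : ℕ) (w : singularCohomology R R X 1) (u : Fin d → singularCohomology R R X 1) :
    cupProduct (Nat.add_comm 1 d) w (cupPowOne R X d u) = cupPowOne R X (d + 1) (Fin.cons w u) := by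
  rw [cupPowOne_succ, Fin.cons_zero, Fin.tail_cons]

/-- `m₁(v) = v₀` (`v ⌣ 1 = v`). [folklore] -/
lemma cupPowOne_one (v : Fin 1 → singularCohomology R R X 1) : cupPowOne R X 1 v = v 0 :=
  cupProduct_one (v 0)

variable {R X}

/-- **A degree-one class squares to zero** when `2` is invertible in `R`: graded commutativity
(Hatcher, Thm. 3.11, the tree's `cupProduct_gradedComm_holds`) gives `v ⌣ v = -(v ⌣ v)`.
[cite: Hatcher2002, Thm. 3.11] -/
lemma cup_self_deg_one [Invertible (2 : R)] (v : singularCohomology R R X 1) :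
    cupProduct (rfl : 1 + 1 = 2) v v = 0 := by
  have h := cupProduct_gradedComm_holds R X (rfl : 1 + 1 = 2) rfl v v
  simp only [mul_one, pow_one, neg_smul, one_smul] at h
  have h2 : (2 : R) • cupProduct (rfl : 1 + 1 = 2) v v = 0 := by
    rw [two_smul]
    nth_rw 1 [h]
    exact neg_add_cancel _
  calc cupProduct (rfl : 1 + 1 = 2) v v = ⅟(2 : R) • ((2 : R) • cupProduct (rfl : 1 + 1 = 2) v v) := by
        rw [smul_smul, invOf_mul_self, one_smul]
    _ = 0 := by rw [h2, smul_zero]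

/-- A degree-one class occurring among the factors kills the product when multiplied on the left:
`u_p ⌣ m_d(u) = 0`. [folklore] -/
lemma cup_cupPowOne_eq_zero_of_eq [Invertible (2 : R)] (d : ℕ) (u : Fin d → singularCohomology R R X 1)
    (p : Fin d) : cupProduct (Nat.add_comm 1 d) (u p) (cupPowOne R X d u) = 0 := by
  induction d with
  | zero => exact p.elim0
  | succ d ih =>
    rw [cupPowOne_succ]
    cases p using Fin.cases with
    | zero =>
      rw [← cupProduct_assoc (rfl : 1 + 1 = 2) (Nat.add_comm 1 d) (by omega) (Nat.add_comm 1 (d + 1)),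
        cup_self_deg_one, LinearMap.map_zero₂]
    | succ q =>
      rw [← cupProduct_assoc (rfl : 1 + 1 = 2) (Nat.add_comm 1 d) (by omega) (Nat.add_comm 1 (d + 1)),
        cupProduct_gradedComm_holds R X (rfl : 1 + 1 = 2) rfl (u q.succ) (u 0)]
      simp only [mul_one, pow_one, neg_smul, one_smul, LinearMap.map_neg₂, neg_eq_zero]
      rw [cupProduct_assoc (rfl : 1 + 1 = 2) (Nat.add_comm 1 d) (by omega) (Nat.add_comm 1 (d + 1))]
      change cupProduct _ (u 0) (cupProduct (Nat.add_comm 1 d) (Fin.tail u q) (cupPowOne R X d (Fin.tail u))) = 0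
      rw [ih (Fin.tail u) q, LinearMap.map_zero]

/-- **The iterated cup product of degree-one classes is alternating** (`⅟2 ∈ R`). [folklore] -/
lemma cupPowOne_eq_zero_of_eq [Invertible (2 : R)] (d : ℕ) (v : Fin d → singularCohomology R R X 1)
    (i j : Fin d) (hv : v i = v j) (hij : i ≠ j) : cupPowOne R X d v = 0 := by
  induction d with
  | zero => exact i.elim0
  | succ d ih =>
    rw [cupPowOne_succ]
    cases i using Fin.cases with
    | zero =>
      cases j using Fin.cases with
      | zero => exact absurd rfl hij
      | succ j' =>
        rw [hv]
        exact cup_cupPowOne_eq_zero_of_eq d (Fin.tail v) j'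
    | succ i' =>
      cases j using Fin.cases with
      | zero =>
        rw [← hv]
        exact cup_cupPowOne_eq_zero_of_eq d (Fin.tail v) i'
      | succ j' =>
        have : cupPowOne R X d (Fin.tail v) = 0 :=
          ih (Fin.tail v) i' j' hv fun e => hij (by rw [e])
        rw [this, LinearMap.map_zero]

variable (R X)

/-- The iterated cup product of degree-one classes as an **alternating map**
`H¹(X; R) [⋀^Fin d]→ₗ[R] Hᵈ(X; R)` (`⅟2 ∈ R`). [folklore] -/
def cupPowOneAlt [Invertible (2 : R)] (d : ℕ) :
    singularCohomology R R X 1 [⋀^Fin d]→ₗ[R] singularCohomology R R X d :=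
  { cupPowOne R X d with
    map_eq_zero_of_eq' := fun v i j hv hij => cupPowOne_eq_zero_of_eq d v i j hv hij }

/-- `cupPowOneAlt` is `cupPowOne` as a function. [folklore] -/
@[simp]
lemma cupPowOneAlt_apply [Invertible (2 : R)] (d : ℕ) (v : Fin d → singularCohomology R R X 1) :
    cupPowOneAlt R X d v = cupPowOne R X d v := rfl

/-! ### The comparison map `⋀ᵈ H¹ → Hᵈ` -/

/-- **The comparison map `⋀ᵈ H¹(X; R) → Hᵈ(X; R)`, `v₀ ∧ ⋯ ∧ v_{d-1} ↦ v₀ ⌣ ⋯ ⌣ v_{d-1}`** ("the canonical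
map induced by the cup product"), the linear map on Mathlib's exterior power corresponding to the
alternating map `cupPowOneAlt` (`exteriorPower.alternatingMapLinearEquiv`).
[cite: LangeBirkenhake1992, Lemma 1.1.17 (b) and Exercise 1.1.6 (7)] -/
def wedgeToCup [Invertible (2 : R)] (d : ℕ) :
    ⋀[R]^d (singularCohomology R R X 1) →ₗ[R] singularCohomology R R X d :=
  exteriorPower.alternatingMapLinearEquiv (cupPowOneAlt R X d)

/-- `wedgeToCup (v₀ ∧ ⋯ ∧ v_{d-1}) = v₀ ⌣ ⋯ ⌣ v_{d-1}`. [folklore] -/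
@[simp]
lemma wedgeToCup_ιMulti [Invertible (2 : R)] (d : ℕ) (v : Fin d → singularCohomology R R X 1) :
    wedgeToCup R X d (exteriorPower.ιMulti R d v) = cupPowOne R X d v :=
  exteriorPower.alternatingMapLinearEquiv_apply_ιMulti _ v

/-- The image of the comparison map is the span of the products of degree-one classes. [folklore] -/
theorem range_wedgeToCup [Invertible (2 : R)] (d : ℕ) :
    LinearMap.range (wedgeToCup R X d) = Submodule.span R (Set.range (cupPowOne R X d)) := by
  rw [LinearMap.range_eq_map, ← exteriorPower.ιMulti_span, Submodule.map_span, ← Set.range_comp]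
  congr 1
  ext x
  exact ⟨fun ⟨v, hv⟩ => ⟨v, by rw [← hv]; exact (wedgeToCup_ιMulti R X d v).symm⟩,
    fun ⟨v, hv⟩ => ⟨v, by rw [← hv]; exact wedgeToCup_ιMulti R X d v⟩⟩

/-! ### Naturality -/

variable {R X}

/-- **Naturality of the iterated product**: `f^*(v₀ ⌣ ⋯ ⌣ v_{d-1}) = f^*v₀ ⌣ ⋯ ⌣ f^*v_{d-1}`
(`f^*` is a ring homomorphism, Hatcher Prop. 3.10; the tree's `cupProduct_map`,
`singularCohomology.map_one`). [cite: Hatcher2002, Prop. 3.10] -/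
theorem map_cupPowOne (f : C(X, Y)) (d : ℕ) (v : Fin d → singularCohomology R R Y 1) :
    singularCohomology.map R R f d (cupPowOne R Y d v) =
      cupPowOne R X d (fun i => singularCohomology.map R R f 1 (v i)) := by
  induction d with
  | zero => simp only [cupPowOne_zero, singularCohomology.map_one]
  | succ d ih =>
    rw [cupPowOne_succ, cupProduct_map, ih]
    rfl

/-- **Naturality of the comparison map**: `f^* ∘ wedgeToCup_Y = wedgeToCup_X ∘ ⋀ᵈ(f^*|_{H¹})` for a
continuous `f : X → Y` (both sides agree on pure wedges by `map_cupPowOne`).  In particular the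
comparison isomorphism of a torus / abelian variety commutes with pull-back by endomorphisms.
[cite: Hatcher2002, Prop. 3.10] -/
theorem map_comp_wedgeToCup [Invertible (2 : R)] (f : C(X, Y)) (d : ℕ) :
    (singularCohomology.map R R f d).hom ∘ₗ wedgeToCup R Y d =
      wedgeToCup R X d ∘ₗ exteriorPower.map d (singularCohomology.map R R f 1).hom := by
  refine exteriorPower.linearMap_ext ?_
  ext v
  simp only [LinearMap.compAlternatingMap_apply, LinearMap.coe_comp, Function.comp_apply,
    wedgeToCup_ιMulti, exteriorPower.map_apply_ιMulti]
  exact map_cupPowOne f d v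

/-- Element form of `map_comp_wedgeToCup`. [cite: Hatcher2002, Prop. 3.10] -/
theorem map_wedgeToCup [Invertible (2 : R)] (f : C(X, Y)) (d : ℕ)
    (x : ⋀[R]^d (singularCohomology R R Y 1)) :
    singularCohomology.map R R f d (wedgeToCup R Y d x) =
      wedgeToCup R X d (exteriorPower.map d (singularCohomology.map R R f 1).hom x) :=
  LinearMap.congr_fun (map_comp_wedgeToCup f d) x

/-! ### The predicate "`H•(X; R) = ⋀• H¹(X; R)`" and its formal consequences -/

variable (R X)

/-- **`H•(X; R)` is the exterior algebra on `H¹(X; R)`**: for every `d` the comparison map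
`wedgeToCup R X d : ⋀ᵈ H¹(X; R) → Hᵈ(X; R)` is bijective.  True for the `n`-torus
(`H•(Tⁿ; R) = Λ_R[α₁, …, αₙ]`, Hatcher Example 3.16) and hence for complex tori and complex abelian
varieties (named fact `Motives.abelianVarietyCohomologyExteriorH1`); a PREDICATE on `(R, X)`, not a
fact. [cite: Hatcher2002, Example 3.16] -/
def HasExteriorCohomologyH1 [Invertible (2 : R)] : Prop :=
  ∀ d : ℕ, Function.Bijective (wedgeToCup R X d)

namespace HasExteriorCohomologyH1

variable {R X} [Invertible (2 : R)]

/-- The comparison isomorphism `⋀ᵈ H¹(X; R) ≃ Hᵈ(X; R)`. [folklore] -/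
def equiv (h : HasExteriorCohomologyH1 R X) (d : ℕ) :
    ⋀[R]^d (singularCohomology R R X 1) ≃ₗ[R] singularCohomology R R X d :=
  LinearEquiv.ofBijective (wedgeToCup R X d) (h d)

/-- The comparison isomorphism is `wedgeToCup`. [folklore] -/
@[simp]
lemma equiv_apply (h : HasExteriorCohomologyH1 R X) (d : ℕ) (x : ⋀[R]^d (singularCohomology R R X 1)) :
    h.equiv d x = wedgeToCup R X d x := rfl

/-- `Hᵈ(X; R)` is spanned by the products `v₀ ⌣ ⋯ ⌣ v_{d-1}` of degree-one classes. [folklore] -/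
theorem span_range_cupPowOne (h : HasExteriorCohomologyH1 R X) (d : ℕ) :
    Submodule.span R (Set.range (cupPowOne R X d)) = ⊤ := by
  rw [← range_wedgeToCup, LinearMap.range_eq_top]
  exact (h d).2

/-- Injectivity of the comparison map, element form: `wedgeToCup x = 0 → x = 0`. [folklore] -/
theorem eq_zero_of_wedgeToCup_eq_zero (h : HasExteriorCohomologyH1 R X) {d : ℕ}
    {x : ⋀[R]^d (singularCohomology R R X 1)} (hx : wedgeToCup R X d x = 0) : x = 0 :=
  (h d).1 (by rw [hx, map_zero])

/-- **`dim Hᵈ(X; R) = (dim H¹(X; R) choose d)`** when `H¹` is finite free (Mathlib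
`exteriorPower.finrank_eq`); for a complex torus of dimension `g`: `b_d = (2g choose d)`
(Lange–Birkenhake, Exercise 1.1.6 (8)). [cite: LangeBirkenhake1992, Exercise 1.1.6 (8)] -/
theorem finrank_eq [Nontrivial R] [Module.Free R (singularCohomology R R X 1)]
    [Module.Finite R (singularCohomology R R X 1)] (h : HasExteriorCohomologyH1 R X) (d : ℕ) :
    Module.finrank R (singularCohomology R R X d) =
      Nat.choose (Module.finrank R (singularCohomology R R X 1)) d := by
  rw [← (h.equiv d).finrank_eq, exteriorPower.finrank_eq]

/-- `Hᵈ(X; R)` is finite free when `H¹` is. [folklore] -/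
theorem finite [Module.Free R (singularCohomology R R X 1)] [Module.Finite R (singularCohomology R R X 1)]
    (h : HasExteriorCohomologyH1 R X) (d : ℕ) : Module.Finite R (singularCohomology R R X d) :=
  Module.Finite.equiv (h.equiv d)

/-- `Hᵈ(X; R)` is free when `H¹` is finite free. [folklore] -/
theorem free [Module.Free R (singularCohomology R R X 1)] [Module.Finite R (singularCohomology R R X 1)]
    (h : HasExteriorCohomologyH1 R X) (d : ℕ) : Module.Free R (singularCohomology R R X d) :=
  Module.Free.of_equiv (h.equiv d)

/-- **`Hᵈ(X; R) = 0` for `d > dim H¹(X; R)`** (`H¹` finite free over a nontrivial `R`). [folklore] -/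
theorem subsingleton_of_lt [Nontrivial R] [Module.Free R (singularCohomology R R X 1)]
    [Module.Finite R (singularCohomology R R X 1)] (h : HasExteriorCohomologyH1 R X) {d : ℕ}
    (hd : Module.finrank R (singularCohomology R R X 1) < d) :
    Subsingleton (singularCohomology R R X d) := by
  haveI := h.free d
  haveI := h.finite d
  rw [← Module.finrank_eq_zero_iff_of_free R, h.finrank_eq, Nat.choose_eq_zero_of_lt hd]

end HasExteriorCohomologyH1

end Literature.AlgebraicTopology.SingularHomology
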